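import Summits.ResolutionOfSingularities.ResolutionOfSingularities.Theorems.PurelyInseparableDim4ResConeStretchKill
import Summits.ResolutionOfSingularities.ResolutionOfSingularities.Theorems.PurelyInseparableDim4ResConeLedgerPersist
import Summits.ResolutionOfSingularities.ResolutionOfSingularities.Theorems.PurelyInseparableDim4ResConeContactSupport
import Summits.ResolutionOfSingularities.ResolutionOfSingularities.Theorems.PurelyInseparableDim4IsolatedPoint
import HarnessLib
import HarnessLib.Audit.Tags

/-!
# Purely inseparable four-folds — SLICE B along a chain, (K11) part 2: the ONE-LETTER LEDGER of a stretch-born KEPT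
# letter at every later stage (`stretch_ledger`) and «NO HEAVY PAIR» of stretch-born kept letters (`stretch_no_heavy_pair`)

[OURS · counted 0 · cell `res-dim4-pi` · K2(p) lane, SLICE-B architecture of record ARCH v1.1 (holder res-dim4-p-12 g3,
brick (K11) «chain-level (DL) assembly» named for res-dim4-p-2 g3 on the bus 2026-08-28T23:30:27Z; part 1 =
`…ResConeStretchKill`) · K lane crit-4 g2.]  Nothing here proves K2(p) = `RidgeBudget.NoAboveFloorTrap p p`,
`NoIsolatedTrap p p` or resolution of singularities in dimension ≥ 4 / characteristic `p`.  AI kernel work, weaker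
than expert review.

Setting: an isolated above-floor `Step0 p` chain `c` with witnesses `(j, b)` (`FreeTail.IsWitnessedChain`), `x^{r₀} ∣ F₀`,
and a constant-shade tail `shade (c k) = d ≥ 1` for `k ≥ k₀`, together with FRAME DATA as hypotheses — the conjuncts of
`ResCone.chain_powerCone_package` (p674751) split à la res-dim4-typ-1 g2's K13: `resForm (c k) = a_k · ℓ_k^d`,
`ℓ_k(j_k) + ℓ_k·b_k = 0`, `λ_k ≠ 0`, `ℓ_{k+1} = λ_k ℓ_k` off `j_k`, some `i ≠ j_k` carries `ℓ_k`.  A letter `a = j_{k₁}`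
BORN in the stretch (`k₁ ≥ k₀`) is KEPT on `(k₁, k)` when `∀ k'' ∈ (k₁, k), j_{k''} ≠ a ∧ b_{k''}(a) = 0` (written out, no
definition).  `G_k := F_k / x^{r_k}`, `T_m := chartTransform m univ j_k ∘ shear j_k b_k`.

* §1 `r_apply_lt_of_isIsolated` — isolation bounds every exceptional multiplicity: `r_a < p` (else the hyperplane
  `x_a = 0` is `p`-fold; `IsolationCert.not_isIsolated_of_le_ordAlong_of_ne_univ`);
* §2 `ledger_kept_step` — ONE KEPT STEP: `1 ≤ r_k(a)`, `u G_k ∈ (x_a, h^d)` (`u(0) ≠ 0`, `h ∈ 𝔪₀`), `j_k ≠ a`, `b_k(a) = 0`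
  and a letter `i₀ ≠ a` carrying `ℓ_k` ⇒ `1 ≤ r_{k+1}(a)`, `(T₀u)(0) ≠ 0`, `T₁h ∈ 𝔪₀`, `T₀u · G_{k+1} ∈ (x_a, (T₁h)^d)`
  (res-dim4-p-3 g3's K4 `ledger_persist` + `ledger_persist_mem_originIdeal`, its `hlin` from res-dim4-p-11 g3's K9
  `exists_homogeneousComponent_one_eq_of_ledger`, `hg` from part 1's `homogeneousComponent_not_mem_span_X_of_powerCone`);
* §3 **`stretch_ledger_core`** / **`stretch_ledger`** (K11a) — for `a = j_{k₁}` kept on `(k₁, k)`, `k₀ ≤ k₁ < k`: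
  `1 ≤ r_k(a)` and a ONE-LETTER LEDGER `u G_k ∈ (x_a, h^d)`, `u(0) ≠ 0`, `h ∈ 𝔪₀`; `stretch_ledger` adds «some `i ≠ a`
  carries `ℓ_k`» (typ-1 g2's K13a `contactSupport_not_subset_single`) and «`coeff_{x_i} h ≠ 0` at EVERY `i ≠ a` carrying
  `ℓ_k`» (part 1's `coeff_single_ne_zero_of_ledger`).  Induction: base = part 1's `stretch_seed_ledger` (K3), step = §2;
* §4 **`stretch_no_heavy_pair`** (K11b, the holder's name, consumed by res-dim4-p-1 g3's K12) — two distinct letters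
  `a = j_{k₁}`, `b′ = j_{k₂}` born in the stretch and kept on `(k₁, k)`, `(k₂, k)`, a third letter `e ∉ {a, b′}` carrying
  `ℓ_k`, `2 ≤ d < p` ⇒ NOT `p ≤ r_k(a) + r_k(b′) + 2` (part 1's `stretch_false_of_two_ledgers` on the two ledgers of §3);
  **`stretch_no_heavy_pair_of_lt`** discharges the third letter by typ-1 g2's K13b `contactSupport_not_subset_pair`
  when `k₁ < k₂`.  BOARD SENTENCE it carries: «on a slice-B stretch, two boundary components born in the stretch and
  kept, with `r_a + r_{b′} ≥ p − 2`, contradict isolation ‖ kernel» = idea-4's I-4-7 (DL) for every `p` and `2 ≤ d < p`.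

[cite: CossartJannsenSaito2020, Thm. 3.10(4), Thm. 3.14]
bears_on: LADDER-RESOLUTION:D157-DOOR2 (res-dim4-pi · K2(p) slice B · (K11) part 2).
Supports stmt-ResolutionOfSingularities-16155 (helper).
-/

set_option linter.dupNamespace false -- mandated namespace of this single-conjunct summit

noncomputable section

namespace Summit.ResolutionOfSingularities.ResolutionOfSingularities.Theorems.PIDim4

namespace ResCone

open MvPolynomial Finset
open Literature.AlgebraicGeometry.Resolution
open Literature.AlgebraicGeometry.Resolution.CentreBlowup
open Literature.AlgebraicGeometry.Resolution.Hauser2010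
open Literature.AlgebraicGeometry.Resolution.HauserPerlega2019
open PointBlowup (polarMap additiveSubspace direction)

variable {K : Type} [Field K]

/-! ## §1 Isolation bounds the exceptional multiplicities -/

/-- **Isolation bounds every exceptional multiplicity**: if `x^r ∣ F` and the origin is an ISOLATED `p`-fold point of
`F`, then `r_a < p` for every letter `a` (otherwise `F` is `p`-fold along the whole hyperplane `x_a = 0`).
[cite: HauserPerlega2019PRIMS, §2 (permissible blowups, `ord_P`)] -/
theorem r_apply_lt_of_isIsolated {p : ℕ} {s : State K} (hiso : IsIsolated p s.F) (hr : ∀ d ∈ s.F.support, s.r ≤ d)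
    (a : Fin 4) : s.r a < p := by
  by_contra h
  refine IsolationCert.not_isIsolated_of_le_ordAlong_of_ne_univ (S := {a}) ?_ (Finset.singleton_ne_univ a) hiso
  unfold ordAlong
  refine Finset.le_inf fun d hd => ?_
  have h1 : s.r a ≤ d a := hr d hd a
  have h2 : degIn {a} d = d a := by rw [degIn, Finset.sum_singleton]
  rw [h2]
  exact_mod_cast (not_lt.mp h).trans h1

section Chain

variable (p : ℕ) [hp : Fact p.Prime] [CharP K p] [DecidableEq K]

/-! ## §2 One kept step -/

omit [CharP K p] in
/-- **ONE KEPT STEP of the ledger** (K4 + K9 with the chain's data): at a stage `k ≥ k₀` of a constant-shade tail with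
frame data `resForm (c k) = C a₀ * (Σ C ℓᵢ Xᵢ)^d` (`d ≥ 1`), `ℓ (j k) + ℓ ⬝ᵥ b k = 0`, a letter `a` KEPT by the step
(`j k ≠ a`, `b k a = 0`) with `1 ≤ r_k(a)`, a letter `i₀ ≠ a` carrying `ℓ`, and a ledger `u · G_k ∈ (x_a, h^d)` with
`u(0) ≠ 0`, `h ∈ 𝔪₀`: then `1 ≤ r_{k+1}(a)`, `(T₀u)(0) ≠ 0`, `T₁h ∈ 𝔪₀` and `T₀u · G_{k+1} ∈ (x_a, (T₁h)^d)`. [OURS]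
[cite: CossartJannsenSaito2020, Thm. 3.10(4), Thm. 3.14] -/
theorem ledger_kept_step {c : ℕ → State K} {j : ℕ → Fin 4} {b : ℕ → Fin 4 → K}
    (hc : ∀ k, IsIsolated p (c k).F ∧ Step0 p (c k) (c (k + 1))) (hw : FreeTail.IsWitnessedChain p c j b)
    (hr0 : ∀ e ∈ (c 0).F.support, (c 0).r ≤ e) (hfloor : ∀ k, ordZero (c k).F ≠ p) {k₀ d : ℕ} (hd : 1 ≤ d)
    (hshade : ∀ k, k₀ ≤ k → (c k).shade = (d : ℕ∞)) {k : ℕ} (hk : k₀ ≤ k) {ℓ : Fin 4 → K} {a₀ : K}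
    (hform : resForm (c k) = C a₀ * (∑ i, C (ℓ i) * X i) ^ d) (hdir : ℓ (j k) + dotProduct ℓ (b k) = 0)
    {a : Fin 4} (hja : j k ≠ a) (hba : b k a = 0) (hra : 1 ≤ (c k).r a) {i₀ : Fin 4} (hi₀a : i₀ ≠ a)
    (hi₀ : ℓ i₀ ≠ 0) {u h : MvPolynomial (Fin 4) K} (hu : MvPolynomial.eval (0 : Fin 4 → K) u ≠ 0)
    (hh : h ∈ originIdeal K)
    (hG : u * ((c k).F.divMonomial (c k).r) ∈ Ideal.span {(X a : MvPolynomial (Fin 4) K), h ^ d}) :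
    1 ≤ (c (k + 1)).r a ∧
      MvPolynomial.eval (0 : Fin 4 → K) (chartTransform 0 Finset.univ (j k) (shear (j k) (b k) u)) ≠ 0 ∧
      chartTransform 1 Finset.univ (j k) (shear (j k) (b k) h) ∈ originIdeal K ∧
      chartTransform 0 Finset.univ (j k) (shear (j k) (b k) u) * ((c (k + 1)).F.divMonomial (c (k + 1)).r) ∈
        Ideal.span {(X a : MvPolynomial (Fin 4) K), chartTransform 1 Finset.univ (j k) (shear (j k) (b k) h) ^ d} := by
  classical
  obtain ⟨o, ho, hpo, -, hod⟩ := chain_shade_nat p hc hfloor hshade hk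
  have hr := IsolatedBand.isolated_chain_forall_le hc hr0 k
  have hck := (hw k).2.2.2.2
  have hbj := (hw k).2.1
  -- the cone is the degree-`d` part of `G_k`, of order exactly `d`, alive at `i₀ ≠ a`
  have hcone : homogeneousComponent d ((c k).F.divMonomial (c k).r) = C a₀ * (∑ i, C (ℓ i) * X i) ^ d := by
    have h1 := hform
    rw [resForm_eq_homogeneousComponent_divMonomial ho hr, hod] at h1
    exact h1
  have ha₀ : a₀ ≠ 0 := ne_zero_of_resForm_eq_C_mul ho hr hform
  have hordG : ordZero ((c k).F.divMonomial (c k).r) = (d : ℕ∞) := by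
    rw [ordZero_divMonomial_eq ho hr, hod]
  have hg := homogeneousComponent_not_mem_span_X_of_powerCone hcone ha₀ hi₀a hi₀
  obtain ⟨κ, κ', -, hlin⟩ := exists_homogeneousComponent_one_eq_of_ledger hd hG hu hh hordG hg hcone
  refine ⟨?_, ?_, ledger_persist_mem_originIdeal (j k) hbj hja hba hh hlin hdir, ?_⟩
  · rw [hck, step_r_univ p (j k) hbj (c k) ho hr, Finsupp.update_apply, if_neg hja.symm, Finsupp.filter_apply,
      if_pos hba]
    exact hra
  · rw [eval_chartTransform_zero_shear]
    exact hu
  · have hG' : u * ((c k).F.divMonomial (c k).r) ∈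
        Ideal.span {(X a : MvPolynomial (Fin 4) K), h ^ (o - (c k).r.degree)} := by
      rw [hod]; exact hG
    have h1 := ledger_persist (j k) hbj ho hr hpo hja hba hra (r_apply_lt_of_isIsolated (hc k).1 hr a) hh hG'
    rw [hod] at h1
    rw [hck]
    exact h1

/-! ## §3 The ledger of a stretch-born kept letter (K11a) -/

omit [CharP K p] in
/-- **THE ONE-LETTER LEDGER of a stretch-born KEPT letter, core** (K11a without the support clauses): along a
constant-shade tail (`d ≥ 1`) with frame data, for `k₀ ≤ k₁ < k` and `a = j_{k₁}` kept on `(k₁, k)`: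
`1 ≤ r_k(a)` and `u · G_k ∈ (x_a, h^d)` for some `u` with `u(0) ≠ 0` and `h ∈ 𝔪₀`.  Induction on `k`: base = the seed
`stretch_seed_ledger` (K3), step = `ledger_kept_step` (K4/K9), the carrying letter from K13a. [OURS]
[cite: CossartJannsenSaito2020, Thm. 3.10(4), Thm. 3.14] -/
theorem stretch_ledger_core {c : ℕ → State K} {j : ℕ → Fin 4} {b : ℕ → Fin 4 → K}
    (hc : ∀ k, IsIsolated p (c k).F ∧ Step0 p (c k) (c (k + 1))) (hw : FreeTail.IsWitnessedChain p c j b)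
    (hr0 : ∀ e ∈ (c 0).F.support, (c 0).r ≤ e) (hfloor : ∀ k, ordZero (c k).F ≠ p) {k₀ d : ℕ} (hd : 1 ≤ d)
    (hshade : ∀ k, k₀ ≤ k → (c k).shade = (d : ℕ∞)) {ℓ : ℕ → Fin 4 → K} {a0 lam : ℕ → K}
    (hform : ∀ k, k₀ ≤ k → resForm (c k) = C (a0 k) * (∑ i, C (ℓ k i) * X i) ^ d)
    (hdir : ∀ k, k₀ ≤ k → ℓ k (j k) + dotProduct (ℓ k) (b k) = 0) (hlam : ∀ k, k₀ ≤ k → lam k ≠ 0)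
    (hprop : ∀ k, k₀ ≤ k → ∀ i, i ≠ j k → ℓ (k + 1) i = lam k * ℓ k i)
    (hcarry : ∀ k, k₀ ≤ k → ∃ i, i ≠ j k ∧ ℓ k i ≠ 0) {k₁ k : ℕ} (hk₁ : k₀ ≤ k₁) (hk : k₁ < k) {a : Fin 4}
    (ha : a = j k₁) (hkept : ∀ k'', k₁ < k'' → k'' < k → j k'' ≠ a ∧ b k'' a = 0) :
    1 ≤ (c k).r a ∧ ∃ u h : MvPolynomial (Fin 4) K, MvPolynomial.eval (0 : Fin 4 → K) u ≠ 0 ∧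
      h ∈ originIdeal K ∧ u * ((c k).F.divMonomial (c k).r) ∈ Ideal.span {(X a : MvPolynomial (Fin 4) K), h ^ d} := by
  classical
  subst ha
  induction k, hk using Nat.le_induction with
  | base =>
    obtain ⟨hr1, hh, hG⟩ := stretch_seed_ledger p hc hw hr0 hfloor hshade hk₁ (hform k₁ hk₁) (hdir k₁ hk₁)
    exact ⟨hr1, 1, _, by rw [map_one]; exact one_ne_zero, hh, hG⟩
  | succ k hk ih =>
    obtain ⟨hja, hba⟩ := hkept k hk (Nat.lt_succ_self k)
    have hkept' : ∀ k'', k₁ < k'' → k'' < k → j k'' ≠ j k₁ ∧ b k'' (j k₁) = 0 :=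
      fun k'' h1 h2 => hkept k'' h1 (Nat.lt_succ_of_lt h2)
    obtain ⟨hra, u, h, hu, hh, hG⟩ := ih hkept'
    obtain ⟨i₀, hi₀a, hi₀⟩ :=
      contactSupport_not_subset_single hdir hlam hprop hcarry (fun k => (hw k).2.1) hk₁ hk hkept'
    have hk0 : k₀ ≤ k := hk₁.trans (Nat.le_of_succ_le hk)
    obtain ⟨hr1, hu1, hh1, hG1⟩ := ledger_kept_step p hc hw hr0 hfloor hd hshade hk0 (hform k hk0) (hdir k hk0)
      hja hba hra hi₀a hi₀ hu hh hG
    exact ⟨hr1, _, _, hu1, hh1, hG1⟩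

omit [CharP K p] in
/-- **THE ONE-LETTER LEDGER of a stretch-born KEPT letter** (K11a, holder's shape): along a constant-shade tail
(`d ≥ 1`) of an isolated above-floor `Step0 p` chain with frame data, for `k₀ ≤ k₁ < k` and `a = j_{k₁}` kept on
`(k₁, k)`: some letter `i ≠ a` carries `ℓ_k` (K13a); `1 ≤ r_k(a)`; and there are `u`, `h` with `u(0) ≠ 0`, `h ∈ 𝔪₀`,
`coeff_{x_i} h ≠ 0` at EVERY letter `i ≠ a` carrying `ℓ_k` (K9), and `u · G_k ∈ (x_a, h^d)`. [OURS]
[cite: CossartJannsenSaito2020, Thm. 3.10(4), Thm. 3.14] -/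
theorem stretch_ledger {c : ℕ → State K} {j : ℕ → Fin 4} {b : ℕ → Fin 4 → K}
    (hc : ∀ k, IsIsolated p (c k).F ∧ Step0 p (c k) (c (k + 1))) (hw : FreeTail.IsWitnessedChain p c j b)
    (hr0 : ∀ e ∈ (c 0).F.support, (c 0).r ≤ e) (hfloor : ∀ k, ordZero (c k).F ≠ p) {k₀ d : ℕ} (hd : 1 ≤ d)
    (hshade : ∀ k, k₀ ≤ k → (c k).shade = (d : ℕ∞)) {ℓ : ℕ → Fin 4 → K} {a0 lam : ℕ → K}
    (hform : ∀ k, k₀ ≤ k → resForm (c k) = C (a0 k) * (∑ i, C (ℓ k i) * X i) ^ d)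
    (hdir : ∀ k, k₀ ≤ k → ℓ k (j k) + dotProduct (ℓ k) (b k) = 0) (hlam : ∀ k, k₀ ≤ k → lam k ≠ 0)
    (hprop : ∀ k, k₀ ≤ k → ∀ i, i ≠ j k → ℓ (k + 1) i = lam k * ℓ k i)
    (hcarry : ∀ k, k₀ ≤ k → ∃ i, i ≠ j k ∧ ℓ k i ≠ 0) {k₁ k : ℕ} (hk₁ : k₀ ≤ k₁) (hk : k₁ < k) {a : Fin 4}
    (ha : a = j k₁) (hkept : ∀ k'', k₁ < k'' → k'' < k → j k'' ≠ a ∧ b k'' a = 0) :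
    (∃ i, i ≠ a ∧ ℓ k i ≠ 0) ∧ 1 ≤ (c k).r a ∧
      ∃ u h : MvPolynomial (Fin 4) K, MvPolynomial.eval (0 : Fin 4 → K) u ≠ 0 ∧ h ∈ originIdeal K ∧
        (∀ i, i ≠ a → ℓ k i ≠ 0 → coeff (Finsupp.single i 1) h ≠ 0) ∧
        u * ((c k).F.divMonomial (c k).r) ∈ Ideal.span {(X a : MvPolynomial (Fin 4) K), h ^ d} := by
  classical
  obtain ⟨hra, u, h, hu, hh, hG⟩ :=
    stretch_ledger_core p hc hw hr0 hfloor hd hshade hform hdir hlam hprop hcarry hk₁ hk ha hkept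
  have hcar : ∃ i, i ≠ a ∧ ℓ k i ≠ 0 := by
    subst ha
    exact contactSupport_not_subset_single hdir hlam hprop hcarry (fun k => (hw k).2.1) hk₁ hk hkept
  have hk0 : k₀ ≤ k := hk₁.trans hk.le
  obtain ⟨o, ho, -, -, hod⟩ := chain_shade_nat p hc hfloor hshade hk0
  have hr := IsolatedBand.isolated_chain_forall_le hc hr0 k
  have hcone : homogeneousComponent d ((c k).F.divMonomial (c k).r) = C (a0 k) * (∑ i, C (ℓ k i) * X i) ^ d := by
    have h1 := hform k hk0
    rw [resForm_eq_homogeneousComponent_divMonomial ho hr, hod] at h1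
    exact h1
  have ha₀ : a0 k ≠ 0 := ne_zero_of_resForm_eq_C_mul ho hr (hform k hk0)
  have hordG : ordZero ((c k).F.divMonomial (c k).r) = (d : ℕ∞) := by
    rw [ordZero_divMonomial_eq ho hr, hod]
  exact ⟨hcar, hra, u, h, hu, hh,
    fun i hia hi => coeff_single_ne_zero_of_ledger hia hd hG hu hh hordG ha₀ hcone hi, hG⟩

/-! ## §4 No heavy pair of stretch-born kept letters (K11b) -/

/-- **NO HEAVY PAIR of stretch-born kept letters** (K11b; idea-4's I-4-7 (DL) for every `p` and `2 ≤ d < p`): along a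
constant-shade tail of an isolated above-floor `Step0 p` chain with `x^{r₀} ∣ F₀` and frame data, two DISTINCT letters
`a = j_{k₁}`, `b′ = j_{k₂}` born in the stretch (`k₁, k₂ ≥ k₀`) and kept on `(k₁, k)`, `(k₂, k)`, and a third letter
`e ∉ {a, b′}` carrying `ℓ_k` (supplied by K13b, see `stretch_no_heavy_pair_of_lt`): the multiplicities at stage `k`
CANNOT satisfy `p ≤ r_k(a) + r_k(b′) + 2`. [OURS] [cite: CossartJannsenSaito2020, Thm. 3.10(4), Thm. 3.14] -/
theorem stretch_no_heavy_pair {c : ℕ → State K} {j : ℕ → Fin 4} {b : ℕ → Fin 4 → K}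
    (hc : ∀ k, IsIsolated p (c k).F ∧ Step0 p (c k) (c (k + 1))) (hw : FreeTail.IsWitnessedChain p c j b)
    (hr0 : ∀ e ∈ (c 0).F.support, (c 0).r ≤ e) (hfloor : ∀ k, ordZero (c k).F ≠ p) {k₀ d : ℕ} (hd2 : 2 ≤ d)
    (hdp : d < p) (hshade : ∀ k, k₀ ≤ k → (c k).shade = (d : ℕ∞)) {ℓ : ℕ → Fin 4 → K} {a0 lam : ℕ → K}
    (hform : ∀ k, k₀ ≤ k → resForm (c k) = C (a0 k) * (∑ i, C (ℓ k i) * X i) ^ d)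
    (hdir : ∀ k, k₀ ≤ k → ℓ k (j k) + dotProduct (ℓ k) (b k) = 0) (hlam : ∀ k, k₀ ≤ k → lam k ≠ 0)
    (hprop : ∀ k, k₀ ≤ k → ∀ i, i ≠ j k → ℓ (k + 1) i = lam k * ℓ k i)
    (hcarry : ∀ k, k₀ ≤ k → ∃ i, i ≠ j k ∧ ℓ k i ≠ 0) {k₁ k₂ k : ℕ} (hk₁ : k₀ ≤ k₁) (hk₂ : k₀ ≤ k₂)
    (h1k : k₁ < k) (h2k : k₂ < k) {a b' : Fin 4} (hab : a ≠ b') (ha : a = j k₁) (hb' : b' = j k₂)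
    (hkept₁ : ∀ k'', k₁ < k'' → k'' < k → j k'' ≠ a ∧ b k'' a = 0)
    (hkept₂ : ∀ k'', k₂ < k'' → k'' < k → j k'' ≠ b' ∧ b k'' b' = 0) {e : Fin 4} (hea : e ≠ a) (heb : e ≠ b')
    (he : ℓ k e ≠ 0) (hheavy : p ≤ (c k).r a + (c k).r b' + 2) : False := by
  have hd : 1 ≤ d := by omega
  obtain ⟨-, ua, ha', hua, hha, hGa⟩ :=
    stretch_ledger_core p hc hw hr0 hfloor hd hshade hform hdir hlam hprop hcarry hk₁ h1k ha hkept₁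
  obtain ⟨-, ub, hb, hub, hhb, hGb⟩ :=
    stretch_ledger_core p hc hw hr0 hfloor hd hshade hform hdir hlam hprop hcarry hk₂ h2k hb' hkept₂
  exact stretch_false_of_two_ledgers p hc hr0 hfloor hd2 hdp hshade (hk₁.trans h1k.le) (hform k (hk₁.trans h1k.le))
    hab hea heb he hua hha hGa hub hhb hGb hheavy

/-- **NO HEAVY PAIR, third letter discharged** (K11b ∘ K13b): for `k₀ ≤ k₁ < k₂ < k` with `j_{k₁} ≠ j_{k₂}` both kept up
to `k`, the vertex form `ℓ_k` lives on a letter off `{j_{k₁}, j_{k₂}}` (res-dim4-typ-1 g2's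
`contactSupport_not_subset_pair`), so `p ≤ r_k(j_{k₁}) + r_k(j_{k₂}) + 2` is impossible outright. [OURS]
[cite: CossartJannsenSaito2020, Thm. 3.10(4), Thm. 3.14] -/
theorem stretch_no_heavy_pair_of_lt {c : ℕ → State K} {j : ℕ → Fin 4} {b : ℕ → Fin 4 → K}
    (hc : ∀ k, IsIsolated p (c k).F ∧ Step0 p (c k) (c (k + 1))) (hw : FreeTail.IsWitnessedChain p c j b)
    (hr0 : ∀ e ∈ (c 0).F.support, (c 0).r ≤ e) (hfloor : ∀ k, ordZero (c k).F ≠ p) {k₀ d : ℕ} (hd2 : 2 ≤ d)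
    (hdp : d < p) (hshade : ∀ k, k₀ ≤ k → (c k).shade = (d : ℕ∞)) {ℓ : ℕ → Fin 4 → K} {a0 lam : ℕ → K}
    (hform : ∀ k, k₀ ≤ k → resForm (c k) = C (a0 k) * (∑ i, C (ℓ k i) * X i) ^ d)
    (hdir : ∀ k, k₀ ≤ k → ℓ k (j k) + dotProduct (ℓ k) (b k) = 0) (hlam : ∀ k, k₀ ≤ k → lam k ≠ 0)
    (hprop : ∀ k, k₀ ≤ k → ∀ i, i ≠ j k → ℓ (k + 1) i = lam k * ℓ k i)
    (hcarry : ∀ k, k₀ ≤ k → ∃ i, i ≠ j k ∧ ℓ k i ≠ 0) {k₁ k₂ k : ℕ} (hk₁ : k₀ ≤ k₁) (h12 : k₁ < k₂)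
    (h2k : k₂ < k) (hab : j k₁ ≠ j k₂)
    (hkept₁ : ∀ k'', k₁ < k'' → k'' < k → j k'' ≠ j k₁ ∧ b k'' (j k₁) = 0)
    (hkept₂ : ∀ k'', k₂ < k'' → k'' < k → j k'' ≠ j k₂ ∧ b k'' (j k₂) = 0)
    (hheavy : p ≤ (c k).r (j k₁) + (c k).r (j k₂) + 2) : False := by
  obtain ⟨e, hea, heb, he⟩ :=
    contactSupport_not_subset_pair hdir hlam hprop hcarry (fun k => (hw k).2.1) hk₁ h12 h2k hkept₁ hkept₂
  exact stretch_no_heavy_pair p hc hw hr0 hfloor hd2 hdp hshade hform hdir hlam hprop hcarry hk₁ (hk₁.trans h12.le)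
    (h12.trans h2k) h2k hab rfl rfl hkept₁ hkept₂ hea heb he hheavy

end Chain

end ResCone

end Summit.ResolutionOfSingularities.ResolutionOfSingularities.Theorems.PIDim4

end
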